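import Summits.ValiantsHypothesis.ValiantsHypothesis.Theorems.DefinabilityGapPivotHall
import HarnessLib

/-!
# DefinabilityGap — pivot matchability with SLACK: at most `65` bad columns (unconditional)

Route `route-ValiantsHypothesis-DefinabilityGap`, residual crux `KIPlantedHitting` (item 23547),
rung `R_K1.1`, ROAD P.  `DefinabilityGapPivotHall.kiPivotMatchableFrom` shows that for `m ≥ 66`
and `|T| ≤ 2q(m)+1` SOME grid column satisfies Hall's condition for the column cells.  The same
counting gives more, and the liveness step (N1) of ROAD P needs the freedom: **all but at most `65`
of the `m` columns are Hall columns** (`card_not_hallCol_le`), so for `m ≥ 66 + j` at least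
`j + 1` columns carry a system of distinct pivot cells.  Proof: a non-Hall column `s` has a violator
`A_s` with `2·pairInc A_s ≥ M(M+6)+2m`, `M = m(m−1)` (`hall_defect` + `col_arith`); putting
`A_s = ∅` on Hall columns and summing, `#bad · (M(M+6)+2m) ≤ 2 Σ_s pairInc A_s ≤ 4|T|(|T|−1)`
(`sum_pairInc_le`), and `|T| ≤ 4m²+5`; `#bad ≥ 66` contradicts `m ≥ 66`.
-/

noncomputable section

open Finset
open Literature.Computability.AlgebraicComplexity Literature.Computability.MetaComplexity
open Summit.ValiantsHypothesis.ValiantsHypothesis.Theorems.DefinabilityGapAffineRung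
open Summit.ValiantsHypothesis.ValiantsHypothesis.Theorems.DefinabilityGapPivotHall

namespace Summit.ValiantsHypothesis.ValiantsHypothesis.Theorems.DefinabilityGapPivotHallSlack

variable {m : ℕ}

/-- Hall's condition for the column cells of the family `T` in grid column `s`. [this file] -/
def HallCol (T : Finset (Fin 3 → Fin (qOf m))) (s : Fin m) : Prop :=
  ∀ A : Finset T, A.card ≤ (A.biUnion (colOf T s)).card

/-- A Hall column carries pairwise distinct pivot cells. [this file] -/
theorem kiPivotMatchable_of_hallCol {T : Finset (Fin 3 → Fin (qOf m))} {s : Fin m}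
    (h : HallCol T s) : KIPivotMatchable m T :=
  kiPivotMatchable_of_hall T s h

open scoped Classical in
/-- **At most `65` non-Hall columns** for `m ≥ 66` and `|T| ≤ 2q(m)+1`. [this file] -/
theorem card_not_hallCol_le (hm : 66 ≤ m) (T : Finset (Fin 3 → Fin (qOf m)))
    (hT : T.card ≤ 2 * qOf m + 1) :
    ((Finset.univ : Finset (Fin m)).filter fun s => ¬ HallCol T s).card ≤ 65 := by
  classical
  set Bad := (Finset.univ : Finset (Fin m)).filter fun s => ¬ HallCol T s with hBad
  -- a violator on every bad column, the empty family elsewhere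
  have hcol : ∀ s : Fin m, ∃ A : Finset T,
      (s ∈ Bad → (A.biUnion (colOf T s)).card < A.card) ∧ (s ∉ Bad → A = ∅) := by
    intro s
    by_cases hs : s ∈ Bad
    · have hs' : ¬ HallCol T s := (Finset.mem_filter.mp hs).2
      have : ∃ A : Finset T, (A.biUnion (colOf T s)).card < A.card := by
        by_contra h
        exact hs' fun A => not_lt.mp fun hlt => h ⟨A, hlt⟩
      obtain ⟨A, hA⟩ := this
      exact ⟨A, fun _ => hA, fun h => absurd hs h⟩
    · exact ⟨∅, fun h => absurd h hs, fun _ => rfl⟩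
  choose A hA using hcol
  have hm2 : 2 ≤ m := by omega
  set M := m * (m - 1) with hMdef
  have hM : M + m = m * m := by
    obtain ⟨x, rfl⟩ : ∃ x, m = x + 1 := ⟨m - 1, by omega⟩
    simp only [hMdef, Nat.add_sub_cancel]
    ring
  have hMe : Even M := Nat.even_mul_pred_self m
  -- every bad column has a large pair incidence
  have percol : ∀ s ∈ Bad, M * (M + 6) + 2 * m ≤ 2 * pairInc (A s) (colOf T s) := by
    intro s hs
    have hAs := (hA s).1 hs
    obtain ⟨k, hk⟩ : ∃ k, (A s).card = k + 1 := ⟨(A s).card - 1, by omega⟩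
    have hd := hall_defect (A s) (colOf T s) m (fun c _ => colCells_card _ _)
    have hp := pairInc_col_le T (A s) s
    rw [hk] at hd hAs hp
    exact col_arith m M k _ _ hm2 hM hMe (by omega) hd (by simpa using hp)
  have hsum : Bad.card * (M * (M + 6) + 2 * m) ≤ 2 * ∑ s, pairInc (A s) (colOf T s) := by
    have h := Finset.sum_le_sum percol
    simp only [Finset.sum_const, smul_eq_mul] at h
    refine h.trans ?_
    rw [Finset.mul_sum]
    exact Finset.sum_le_sum_of_subset (Finset.filter_subset _ _)
  have hglob := sum_pairInc_le T A
  have hq : qOf m ≤ 2 * (m * m + 1) := leastPrimeGe_le _ (by omega)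
  have hN : T.card ≤ 4 * (m * m) + 5 := by omega
  have hNN : T.card * (T.card - 1) ≤ (4 * (m * m) + 5) * (4 * (m * m) + 4) :=
    Nat.mul_le_mul hN (by omega)
  have H : Bad.card * (M * (M + 6) + 2 * m) ≤ 4 * ((4 * (m * m) + 5) * (4 * (m * m) + 4)) := by
    calc Bad.card * (M * (M + 6) + 2 * m)
        ≤ 2 * ∑ s, pairInc (A s) (colOf T s) := hsum
      _ ≤ 2 * (2 * (T.card * (T.card - 1))) := Nat.mul_le_mul_left 2 hglob
      _ ≤ 2 * (2 * ((4 * (m * m) + 5) * (4 * (m * m) + 4))) :=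
          Nat.mul_le_mul_left 2 (Nat.mul_le_mul_left 2 hNN)
      _ = 4 * ((4 * (m * m) + 5) * (4 * (m * m) + 4)) := by ring
  by_contra hbad
  have hbad : 66 ≤ Bad.card := by omega
  have H66 : 66 * (M * (M + 6) + 2 * m) ≤ 4 * ((4 * (m * m) + 5) * (4 * (m * m) + 4)) :=
    (Nat.mul_le_mul_right _ hbad).trans H
  have f4 : 66 * m ≤ m * m := Nat.mul_le_mul_right m hm
  have hM1 : 65 * m ≤ M := by omega
  have f2 : 65 * m * M ≤ M * M := Nat.mul_le_mul_right M hM1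
  have f3 : 65 * m * m ≤ M * m := Nat.mul_le_mul_right m hM1
  have f5 : (M + m) * (M + m) = (m * m) * (m * m) := by rw [hM]
  nlinarith [f2, f3, f5, hM, H66, f4]

open scoped Classical in
/-- **Many Hall columns.** For `m ≥ 66` at least `m − 65` columns are Hall columns; in particular
(`m ≥ 66`) one is, recovering `kiPivotMatchableFrom`. [this file] -/
theorem le_card_hallCol (hm : 66 ≤ m) (T : Finset (Fin 3 → Fin (qOf m)))
    (hT : T.card ≤ 2 * qOf m + 1) :
    m - 65 ≤ ((Finset.univ : Finset (Fin m)).filter fun s => HallCol T s).card := by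
  classical
  have h := card_not_hallCol_le hm T hT
  have hsplit := Finset.card_filter_add_card_filter_not
    (s := (Finset.univ : Finset (Fin m))) (fun s => HallCol T s)
  rw [Finset.card_univ, Fintype.card_fin] at hsplit
  omega

end Summit.ValiantsHypothesis.ValiantsHypothesis.Theorems.DefinabilityGapPivotHallSlack
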